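import Literature.Probability.Percolation.ParaPivotalArms
import Literature.Probability.Percolation.NearCriticalScaling
import HarnessLib

/-!
# Four arms around a cut point: the padded Hex-lemma duality (proofs, one auxiliary definition)

Topic `Literature/Probability/Percolation`; family `crit-perc`, statement **crit-perc.S16**
(`Literature.Probability.Percolation.triTheta_exponent`). The planar-duality step behind the
pivotal estimates for the **one-arm event** in Kesten's near-critical theory (Nolin 2008, §6.2,
proof of Thm. 27, Case 1, "The key remark is that the summand can be expressed in terms of arm
events … Put now a rhombus `R(v)` around `v`: … `v` is connected to `∂R(v)` by `4` arms of
alternating colors. Indeed, `r₁` provides two black arms, and `c₁` two white arms" [arXiv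
0711.4948: Thm. 26, Fig. 8]; Werner 2009, Lecture 6, §5, figure "A pivotal point for
`0 ↔ ∂Λ_n`, the corresponding four-arm event and one-arm event"; Kesten 1987, Lemma 8).

**The cut-point lemma** (`armEvent_of_cutPoint`). Let `ξ` be a site configuration of `𝕋`, `d ≥ 1`,
`P = [-d, d]²` the lattice parallelogram about the origin (`triSqBox d`), and suppose two open
`𝕋`-paths `α`, `β` run inside `P \ {0}` from neighbours of `0` to sites `a`, `b` with
`|a|_𝕋, |b|_𝕋 ≥ d`, `a` and `b` on the boundary of `P`, in such a way that **no open path inside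
`P \ {0}` joins a site of `α` to a site of `β`** (the origin is a cut point between them). Then
`ξ` has four pairwise disjoint arms open/closed/open/closed from `∂Λ₁` to `∂Λ_d` inside
`Λ_d \ {0}` (`armEvent ![T, F, T, F] 1 d`). The two closed arms come from the Hex lemma
(`tri_hex`, Bollobás–Riordan 2006, Ch. 5, Lemma 7) applied to the padded parallelogram
`P⁺ = [-d-3, d+3]²` coloured as follows: `ξ` on `P \ {0}`, and outside `P` everything white except
two black *wires*, one from (just outside) `a` to the right side of `P⁺`, one from `b` to the left
side of `P⁺`, routed so that they touch `P` only next to `a`, resp. `b`, and do not touch each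
other (`CutPointWires`). A black left–right crossing of `P⁺` would join `α` to `β` inside
`P \ {0}` — excluded — so there is a white top–bottom crossing `κ`; colouring `0` black, the wires
and `α ∪ {0} ∪ β` form a black left–right crossing, so by the exclusivity half of the Hex lemma
(`tri_hex_excl`) `κ` passes through `0`, and its two halves, which are disjoint for the same
reason, are the closed arms (inside `P` white means closed). The wires are laid explicitly for
`a` on the right side of `P` and the five possible positions of `b` (left, top, bottom side;
right side below or above `a`); the general position of `a` is reduced to this one by the
symmetries `z ↦ -z` and `(z₀, z₁) ↦ (z₁, z₀)` of `𝕋`, which preserve `P`, `Λ_d` and the arm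
events (`mem_armEvent_of_relabel_iso`, `armEvent_of_cutPoint_iso`). The wire-laying lemmas are
`exists_wireA`, `exists_cutPointWires_left/top/bottom/right_below/right_above`,
`exists_cutPointWires`; the core argument is `armEvent_of_cutPoint_of_wires`.

**Application to the one-arm event** (`relabel_shift_mem_armEvent_of_isPivotal_triOneArm`): if
`v` is pivotal for `{0 ↔ ∂Λ_N}` (`triOneArm N`) and `2d + 1 ≤ |v|_𝕋 ≤ N - 2d`, then `ω - v` lies in
`armEvent ![T, F, T, F] 1 d`: the open path of `ω ∪ {v}` from `0` to `∂Λ_N` passes through `v`,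
its two halves leave `v + P` and cannot be joined by an open path of `ω \ {v}` (that would bypass
`v`), so the cut-point lemma applies to `ξ = ω - v`.

Auxiliary definitions: `triSqBox L = ↑(box 2 L) = {z | |z₀| ≤ L ∧ |z₁| ≤ L}` (a `Set` abbreviation of
the tree's `box`), its corner `triSqCorner L = (L, L)`
(translation onto `rectangle (2L) (2L)`, for `tri_hex_triSqBox` / `tri_hex_excl_triSqBox`), and the wire
predicate `CutPointWires` (a structure of hypotheses, not data of the theory). Also proved here:
the lattice-segment paths `pathIn_hline/vline`, `pathIn_of_hseg/vseg`, and `triNorm_transposeIso`,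
`triNorm_add_le`, `triNorm_le_abs_add_abs`.

Not here: the probability estimate `P_t(v pivotal for 0 ↔ ∂Λ_N) ≤ P_t(0 ↔ ∂Λ_m) π̂_t(1, d) P_t(∂Λ_{m'} ↝ ∂Λ_N)`
(independence of the three pieces) and the summation over `v` — next file.

## References

* P. Nolin, Near-critical percolation in two dimensions, *Electron. J. Probab.* 13 (2008),
  §6.2, proof of Thm. 27, Case 1 and Fig. 8 [arXiv 0711.4948: Thm. 26] [Nolin2008].
* W. Werner, *Lectures on two-dimensional critical percolation*, IAS/Park City Math. Ser. 16
  (2009), Lecture 6, §5 [WernerPCMI2009].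
* H. Kesten, Scaling relations for 2D-percolation, *Comm. Math. Phys.* 109 (1987), Lemma 8
  [KestenScalingCMP1987].
* B. Bollobás, O. Riordan, *Percolation*, CUP (2006), Ch. 5, Lemma 7 (Hex lemma)
  [BollobasRiordan2006].

Tree: `tri_hex` (`TriHexLemma.lean`), `tri_hex_excl` (`TriHexExclusive.lean`), `PathIn` API
(`SitePaths.lean`, `TriRSWChaining.lean`, `OneArmLSW.lean`), `triShiftIso`, `triNegIso`,
`triSwapIso`, `triGraph_adj_iff_coord` (`TriAnnulusCircuit.lean`), and from `ParaPivotalArms.lean`: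
`PathIn.split_at`, `PathIn.exists_trunc_arm`, `mem_armEvent_of_pathIn`,
`isPivotal_iff_insert_mem_and_notMem`, `triNorm_sub_eq_one_of_adj`, `one_le_triNorm_sub_of_ne`.
-/

noncomputable section

open MeasureTheory Set

namespace Literature.Probability.Percolation

open LatticeModels

/-! ### The box `[-L, L]²` and the Hex lemma for it -/

/-- The lattice parallelogram `[-L, L]² = {z | |z₀| ≤ L ∧ |z₁| ≤ L}` of `𝕋` about the origin, as a set
of sites: the coercion of the tree's centred cube `box 2 L` (`ThermodynamicLimit.lean`; a translate
of `rectangle (2L) (2L)`). A transparent abbreviation kept for readability of the many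
`S ⊆ triSqBox d \ {0}` hypotheses below; all Finset facts (`box_mono`, `card_box`, …) apply through
`triSqBox_eq_coe_box`. [folklore] -/
def triSqBox (L : ℕ) : Set (Site 2) := ↑(box 2 L)

/-- `triSqBox L` is the coerced Finset `box 2 L`. [folklore] -/
theorem triSqBox_eq_coe_box (L : ℕ) : triSqBox L = ↑(box 2 L) := rfl

/-- Membership in `triSqBox`, unfolded. [folklore] -/
@[simp] theorem mem_triSqBox {L : ℕ} {z : Site 2} : z ∈ triSqBox L ↔ |z 0| ≤ L ∧ |z 1| ≤ L := by
  rw [triSqBox, Finset.mem_coe, mem_box, Fin.forall_fin_two, abs_le, abs_le]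

/-- `triSqBox` is monotone in the size (`box_mono`). [folklore] -/
theorem triSqBox_mono {L L' : ℕ} (h : L ≤ L') : triSqBox L ⊆ triSqBox L' := fun _ hz =>
  Finset.mem_coe.2 (box_mono 2 h (Finset.mem_coe.1 hz))

/-- The hexagon `Λ_L` lies in the box `[-L, L]²`. [folklore] -/
theorem mem_triSqBox_of_triNorm_le {L : ℕ} {z : Site 2} (h : triNorm z ≤ L) : z ∈ triSqBox L := by
  obtain ⟨h0, h1, -⟩ := abs_le_triNorm z
  exact mem_triSqBox.2 ⟨h0.trans h, h1.trans h⟩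

/-- The corner `(L, L)` used to translate `[-L, L]²` onto `rectangle (2L) (2L)`. [folklore] -/
def triSqCorner (L : ℕ) : Site 2 := ![(L : ℤ), L]

/-- First coordinate of `triSqCorner`. [folklore] -/
@[simp] theorem triSqCorner_zero (L : ℕ) : triSqCorner L 0 = L := rfl

/-- Second coordinate of `triSqCorner`. [folklore] -/
@[simp] theorem triSqCorner_one (L : ℕ) : triSqCorner L 1 = L := rfl

/-- `z ∈ [-L, L]²` iff `z + (L, L) ∈ rectangle (2L) (2L)`. [folklore] -/
theorem mem_triSqBox_iff_add_mem_rectangle {L : ℕ} {z : Site 2} :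
    z ∈ triSqBox L ↔ z + triSqCorner L ∈ (↑(rectangle (2 * L) (2 * L)) : Set (Site 2)) := by
  rw [mem_triSqBox, Finset.mem_coe, mem_rectangle_iff]
  simp only [Pi.add_apply, triSqCorner_zero, triSqCorner_one, abs_le]
  push_cast
  omega

/-- The image under `z ↦ z - (L, L)` of `rectangle (2L) (2L) ∩ B'`, `B' = {w | w - (L,L) ∈ B}`,
is `[-L, L]² ∩ B`. [folklore] -/
theorem image_shift_rectangle_inter_triSqBox {L : ℕ} (B : Set (Site 2)) :
    (triShiftIso (-triSqCorner L)) '' ((↑(rectangle (2 * L) (2 * L)) : Set (Site 2)) ∩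
        {w | w - triSqCorner L ∈ B}) = triSqBox L ∩ B := by
  ext z
  simp only [Set.mem_image, Set.mem_inter_iff, triShiftIso_apply, Set.mem_setOf_eq]
  constructor
  · rintro ⟨w, ⟨hw1, hw2⟩, rfl⟩
    refine ⟨?_, by rwa [← sub_eq_add_neg]⟩
    rw [mem_triSqBox_iff_add_mem_rectangle, neg_add_cancel_right]
    exact hw1
  · rintro ⟨hz1, hz2⟩
    refine ⟨z + triSqCorner L, ⟨mem_triSqBox_iff_add_mem_rectangle.1 hz1, by simpa using hz2⟩, ?_⟩
    simp [← sub_eq_add_neg]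

/-- **Hex lemma for `[-L, L]²`** (Bollobás–Riordan 2006, Ch. 5, Lemma 7, transported from
`tri_hex` by translation): every colouring `B` has a black path inside `[-L, L]²` from the left
side `{z₀ = -L}` to the right side `{z₀ = L}`, or a white path inside `[-L, L]²` from the bottom
side `{z₁ = -L}` to the top side `{z₁ = L}`. [cite: BollobasRiordan2006, Ch. 5 Lemma 7] -/
theorem tri_hex_triSqBox (L : ℕ) (B : Set (Site 2)) :
    (∃ x y, x 0 = -(L : ℤ) ∧ y 0 = (L : ℤ) ∧ PathIn triGraph (triSqBox L ∩ B) x y) ∨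
      (∃ x y, x 1 = -(L : ℤ) ∧ y 1 = (L : ℤ) ∧ PathIn triGraph (triSqBox L ∩ Bᶜ) x y) := by
  set B' : Set (Site 2) := {w | w - triSqCorner L ∈ B} with hB'
  have hB'c : B'ᶜ = {w | w - triSqCorner L ∈ Bᶜ} := by ext w; simp [hB']
  have e0 : ∀ z : Site 2, (triShiftIso (-triSqCorner L) z) 0 = z 0 - L := fun z => by
    simp [triShiftIso_apply, sub_eq_add_neg]
  have e1 : ∀ z : Site 2, (triShiftIso (-triSqCorner L) z) 1 = z 1 - L := fun z => by
    simp [triShiftIso_apply, sub_eq_add_neg]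
  rcases tri_hex (2 * L) (2 * L) B' with ⟨x, hx, y, hy, hp⟩ | ⟨x, hx, y, hy, hp⟩
  · left
    have hp' := pathIn_map_iso (triShiftIso (-triSqCorner L)) hp
    rw [image_shift_rectangle_inter_triSqBox] at hp'
    refine ⟨_, _, ?_, ?_, hp'⟩
    · have := (Finset.mem_filter.1 hx).2
      rw [e0, this]; ring
    · have := (Finset.mem_filter.1 hy).2
      rw [e0, this]; push_cast; ring
  · right
    have hp' := pathIn_map_iso (triShiftIso (-triSqCorner L)) hp
    rw [hB'c, image_shift_rectangle_inter_triSqBox] at hp'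
    refine ⟨_, _, ?_, ?_, hp'⟩
    · have := (Finset.mem_filter.1 hx).2
      rw [e1, this]; ring
    · have := (Finset.mem_filter.1 hy).2
      rw [e1, this]; push_cast; ring

/-- **Exclusivity of the Hex lemma for `[-L, L]²`** (Bollobás–Riordan 2006, Ch. 5, Lemma 7,
transported from `tri_hex_excl`): a black left–right path and a white bottom–top path inside
`[-L, L]²` cannot coexist. [cite: BollobasRiordan2006, Ch. 5 Lemma 7] -/
theorem tri_hex_excl_triSqBox (L : ℕ) (B : Set (Site 2)) {x y u w : Site 2} (hx : x 0 = -(L : ℤ))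
    (hy : y 0 = (L : ℤ)) (hxy : PathIn triGraph (triSqBox L ∩ B) x y) (hu : u 1 = -(L : ℤ))
    (hw : w 1 = (L : ℤ)) (huw : PathIn triGraph (triSqBox L ∩ Bᶜ) u w) : False := by
  set B' : Set (Site 2) := {z | z - triSqCorner L ∈ B} with hB'
  have himg : ∀ (C : Set (Site 2)), (triShiftIso (triSqCorner L)) '' (triSqBox L ∩ C) =
      (↑(rectangle (2 * L) (2 * L)) : Set (Site 2)) ∩ {z | z - triSqCorner L ∈ C} := by
    intro C; ext z
    simp only [Set.mem_image, Set.mem_inter_iff, triShiftIso_apply, Set.mem_setOf_eq]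
    constructor
    · rintro ⟨z', ⟨hz1, hz2⟩, rfl⟩
      exact ⟨mem_triSqBox_iff_add_mem_rectangle.1 hz1, by simpa using hz2⟩
    · rintro ⟨hz1, hz2⟩
      refine ⟨z - triSqCorner L, ⟨?_, hz2⟩, by simp⟩
      rw [mem_triSqBox_iff_add_mem_rectangle, sub_add_cancel]; exact hz1
  have hxy' := pathIn_map_iso (triShiftIso (triSqCorner L)) hxy
  have huw' := pathIn_map_iso (triShiftIso (triSqCorner L)) huw
  rw [himg] at hxy' huw'
  have hBc : {z : Site 2 | z - triSqCorner L ∈ Bᶜ} = B'ᶜ := by ext z; simp [hB']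
  rw [hBc] at huw'
  have hxB := hxy.left_mem.1
  have hyB := hxy.right_mem.1
  have huB := huw.left_mem.1
  have hwB := huw.right_mem.1
  rw [mem_triSqBox, abs_le, abs_le] at hxB hyB huB hwB
  have e0 : ∀ z : Site 2, (triShiftIso (triSqCorner L) z) 0 = z 0 + L := fun z => by
    simp [triShiftIso_apply]
  have e1 : ∀ z : Site 2, (triShiftIso (triSqCorner L) z) 1 = z 1 + L := fun z => by
    simp [triShiftIso_apply]
  have hmem : ∀ z : Site 2, -(L : ℤ) ≤ z 0 ∧ z 0 ≤ L → -(L : ℤ) ≤ z 1 ∧ z 1 ≤ L →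
      triShiftIso (triSqCorner L) z ∈ rectangle (2 * L) (2 * L) := by
    intro z h0 h1
    rw [mem_rectangle_iff, e0, e1]; push_cast; omega
  refine tri_hex_excl (2 * L) (2 * L) B' ?_ ?_ hxy' ?_ ?_ huw'
  · refine Finset.mem_filter.2 ⟨hmem x ⟨hxB.1.1, hxB.1.2⟩ ⟨hxB.2.1, hxB.2.2⟩, ?_⟩
    rw [e0, hx]; ring
  · refine Finset.mem_filter.2 ⟨hmem y ⟨hyB.1.1, hyB.1.2⟩ ⟨hyB.2.1, hyB.2.2⟩, ?_⟩
    rw [e0, hy]; push_cast; ring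
  · refine Finset.mem_filter.2 ⟨hmem u ⟨huB.1.1, huB.1.2⟩ ⟨huB.2.1, huB.2.2⟩, ?_⟩
    rw [e1, hu]; ring
  · refine Finset.mem_filter.2 ⟨hmem w ⟨hwB.1.1, hwB.1.2⟩ ⟨hwB.2.1, hwB.2.2⟩, ?_⟩
    rw [e1, hw]; push_cast; ring

/-! ### Wires -/

/-- **Wires for the padded Hex lemma.** Data-free hypotheses on two finite sets of sites `Wa`,
`Wb` (the black paint outside `P = [-d, d]²`, inside `P⁺ = [-d-3, d+3]²`): they avoid `P`, touch
`P` only next to `a` (at `a` or at one fixed neighbour `a'` of `a` in `P`), resp. next to `b`,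
do not touch each other, `Wa` reaches the right side of `P⁺` but not its left side, `Wb` the
left side but not the right side, and each is joined to its attaching site by a path.
[cite: BollobasRiordan2006, Ch. 5 Lemma 7 (padding device)] -/
structure CutPointWires (d : ℕ) (a a' b b' : Site 2) (Wa Wb : Set (Site 2)) : Prop where
  Wa_sub : Wa ⊆ triSqBox (d + 3)
  Wb_sub : Wb ⊆ triSqBox (d + 3)
  Wa_out : ∀ z ∈ Wa, z ∉ triSqBox d
  Wb_out : ∀ z ∈ Wb, z ∉ triSqBox d
  a'_mem : a' ∈ triSqBox d
  b'_mem : b' ∈ triSqBox d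
  a'_adj : a' = a ∨ triGraph.Adj a a'
  b'_adj : b' = b ∨ triGraph.Adj b b'
  Wa_touch : ∀ p ∈ Wa, ∀ q ∈ triSqBox d, triGraph.Adj p q → q = a ∨ q = a'
  Wb_touch : ∀ p ∈ Wb, ∀ q ∈ triSqBox d, triGraph.Adj p q → q = b ∨ q = b'
  apart : ∀ p ∈ Wa, ∀ q ∈ Wb, ¬ triGraph.Adj p q
  disj : Disjoint Wa Wb
  Wa_left : ∀ z ∈ Wa, z 0 ≠ -((d : ℤ) + 3)
  Wb_right : ∀ z ∈ Wb, z 0 ≠ (d : ℤ) + 3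
  Wa_path : ∃ e ∈ Wa, e 0 = (d : ℤ) + 3 ∧ PathIn triGraph (insert a Wa) a e
  Wb_path : ∃ e ∈ Wb, e 0 = -((d : ℤ) + 3) ∧ PathIn triGraph (insert b Wb) b e

/-! ### The cut-point lemma, given wires -/

section CutPoint

variable {d : ℕ} {ξ : SiteConfig (Site 2)} {Sα Sβ Wa Wb : Set (Site 2)} {a₁ a a' b₁ b b' : Site 2}

/-- **The cut-point lemma with given wires** (the padded Hex-lemma argument described in the
module docstring). [cite: Nolin2008, §6.2, proof of Thm. 27, Case 1 (arXiv 0711.4948: Thm. 26, Fig. 8)] [cite: BollobasRiordan2006, Ch. 5 Lemma 7] -/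
theorem armEvent_of_cutPoint_of_wires (hd : 1 ≤ d) (hW : CutPointWires d a a' b b' Wa Wb)
    (hSα : Sα ⊆ (triSqBox d \ {0}) ∩ ξ) (hSβ : Sβ ⊆ (triSqBox d \ {0}) ∩ ξ)
    (ha₁ : triGraph.Adj a₁ 0) (hb₁ : triGraph.Adj b₁ 0) (hα : PathIn triGraph Sα a₁ a)
    (hβ : PathIn triGraph Sβ b₁ b) (hda : (d : ℤ) ≤ triNorm a) (hdb : (d : ℤ) ≤ triNorm b)
    (H : ∀ z ∈ Sα, ∀ z' ∈ Sβ, ¬ PathIn triGraph ((triSqBox d \ {0}) ∩ ξ) z z') :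
    ξ ∈ armEvent ![true, false, true, false] 1 d := by
  classical
  set L : ℕ := d + 3 with hL
  set P : Set (Site 2) := triSqBox d with hP
  -- the colourings
  set B₀ : Set (Site 2) := Wa ∪ Wb ∪ ((P \ {0}) ∩ ξ) with hB₀
  set B₁ : Set (Site 2) := insert 0 B₀ with hB₁
  have hPL : P ⊆ triSqBox L := triSqBox_mono (by omega)
  have h0P : (0 : Site 2) ∈ P := by rw [hP, mem_triSqBox]; simp
  have haSα : a ∈ Sα := hα.right_mem
  have hbSβ : b ∈ Sβ := hβ.right_mem
  have ha₁Sα : a₁ ∈ Sα := hα.left_mem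
  have hb₁Sβ : b₁ ∈ Sβ := hβ.left_mem
  have hB₀B₁ : B₀ ⊆ B₁ := subset_insert _ _
  -- (1) the black left–right crossing of `P⁺` under `B₁`
  obtain ⟨ea, hea, hea0, hpa⟩ := hW.Wa_path
  obtain ⟨eb, heb, heb0, hpb⟩ := hW.Wb_path
  have hSαB : Sα ⊆ triSqBox L ∩ B₁ := fun z hz =>
    ⟨hPL (hSα hz).1.1, hB₀B₁ (Or.inr (hSα hz))⟩
  have hSβB : Sβ ⊆ triSqBox L ∩ B₁ := fun z hz =>
    ⟨hPL (hSβ hz).1.1, hB₀B₁ (Or.inr (hSβ hz))⟩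
  have haWa : insert a Wa ⊆ triSqBox L ∩ B₁ := by
    rintro z (rfl | hz)
    · exact hSαB haSα
    · exact ⟨hW.Wa_sub hz, hB₀B₁ (Or.inl (Or.inl hz))⟩
  have hbWb : insert b Wb ⊆ triSqBox L ∩ B₁ := by
    rintro z (rfl | hz)
    · exact hSβB hbSβ
    · exact ⟨hW.Wb_sub hz, hB₀B₁ (Or.inl (Or.inr hz))⟩
  have h0B₁ : (0 : Site 2) ∈ triSqBox L ∩ B₁ := ⟨hPL h0P, mem_insert _ _⟩
  have hcross : PathIn triGraph (triSqBox L ∩ B₁) eb ea :=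
    (((((hpb.mono hbWb).symm.trans (hβ.mono hSβB).symm).tail hb₁ h0B₁).tail ha₁.symm
      (hSαB ha₁Sα)).trans (hα.mono hSαB)).trans (hpa.mono haWa)
  have hexcl : ∀ {u w : Site 2}, u 1 = -(L : ℤ) → w 1 = L →
      PathIn triGraph (triSqBox L ∩ B₁ᶜ) u w → False := fun hu hw huw =>
    tri_hex_excl_triSqBox L B₁ (by rw [heb0, hL]; push_cast; ring) (by rw [hea0, hL]; push_cast; ring)
      hcross hu hw huw
  -- (2) no black left–right crossing of `P⁺` under `B₀`
  have hnoblack : ∀ {x y : Site 2}, x 0 = -(L : ℤ) → y 0 = L →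
      PathIn triGraph (triSqBox L ∩ B₀) x y → False := by
    intro x y hx hy hp
    -- the endpoints lie on the wires
    have hxWb : x ∈ Wb := by
      rcases hp.left_mem.2 with (h | h) | h
      · exact absurd hx (hW.Wa_left x h)
      · exact h
      · have := (h.1.1 : x ∈ triSqBox d); rw [mem_triSqBox, abs_le] at this; omega
    have hyWa : y ∈ Wa := by
      rcases hp.right_mem.2 with (h | h) | h
      · exact h
      · exact absurd hy (hW.Wb_right y h)
      · have := (h.1.1 : y ∈ triSqBox d); rw [mem_triSqBox, abs_le] at this; omega
    have hyWb : y ∉ Wb := fun h => Set.disjoint_left.1 hW.disj hyWa h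
    -- last exit from `Wb`
    obtain ⟨p, q, hpWb, -, hqWb, hpq, hq⟩ := hp.last_exit hxWb hyWb
    have hqmem := hq.left_mem
    have hqP : q ∈ P ∧ q ≠ 0 ∧ q ∈ ξ := by
      rcases hqmem.1.2 with (h | h) | h
      · exact absurd hpq.symm (hW.apart q h p hpWb)
      · exact absurd h hqmem.2
      · exact ⟨h.1.1, h.1.2, h.2⟩
    have hqb : q = b ∨ q = b' := hW.Wb_touch p hpWb q hqP.1 hpq
    -- first entry into `Wa`
    have hqWa : q ∈ Waᶜ := fun h => hW.Wa_out q h hqP.1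
    have hyWa' : y ∉ Waᶜ := fun h => h hyWa
    obtain ⟨r, s, hrWa, hsWa, -, hrs, hqr⟩ := hq.exit hqWa hyWa'
    simp only [mem_compl_iff, not_not] at hsWa
    have hsub : Waᶜ ∩ ((triSqBox L ∩ B₀) \ Wb) ⊆ (P \ {0}) ∩ ξ := by
      rintro z ⟨hzWa, ⟨-, (h | h) | h⟩, hzWb⟩
      · exact absurd h hzWa
      · exact absurd h hzWb
      · exact h
    have hqr' : PathIn triGraph ((P \ {0}) ∩ ξ) q r := hqr.mono hsub
    have hrP := hqr'.right_mem
    have hra : r = a ∨ r = a' := hW.Wa_touch s hsWa r hrP.1.1 hrs.symm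
    -- extend to a path from `b` to `a`
    have hqmem' : q ∈ (P \ {0}) ∩ ξ := hqr'.left_mem
    have hbq : PathIn triGraph ((P \ {0}) ∩ ξ) b q := by
      have hqb' : q = b ∨ triGraph.Adj b q := by
        rcases hqb with h | h
        · exact Or.inl h
        · rw [h]; exact hW.b'_adj
      rcases hqb' with h | h
      · rw [h] at hqmem' ⊢; exact PathIn.refl hqmem'
      · exact PathIn.of_adj (hSβ hbSβ) hqmem' h
    have hra' : PathIn triGraph ((P \ {0}) ∩ ξ) r a := by
      have hra'' : r = a ∨ triGraph.Adj a r := by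
        rcases hra with h | h
        · exact Or.inl h
        · rw [h]; exact hW.a'_adj
      rcases hra'' with h | h
      · rw [h] at hrP; rw [h]; exact PathIn.refl hrP
      · exact PathIn.of_adj hrP (hSα haSα) h.symm
    exact H a haSα b hbSβ ((hbq.trans hqr').trans hra').symm
  -- (3) hence a white bottom–top crossing `κ` of `P⁺` under `B₀`, which passes through `0`
  obtain ⟨x, y, hx, hy, hκ⟩ := (tri_hex_triSqBox L B₀).resolve_left
    (fun ⟨x, y, hx, hy, hp⟩ => hnoblack hx hy hp)
  have hB₁c : (triSqBox L ∩ B₀ᶜ) \ {0} ⊆ triSqBox L ∩ B₁ᶜ := by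
    rintro z ⟨⟨hz1, hz2⟩, hz0⟩
    refine ⟨hz1, fun h => ?_⟩
    rcases mem_insert_iff.1 h with h | h
    · exact hz0 h
    · exact hz2 h
  have hx0 : x ≠ 0 := by intro h; rw [h, Pi.zero_apply] at hx; omega
  have hy0 : y ≠ 0 := by intro h; rw [h, Pi.zero_apply] at hy; omega
  rcases hκ.split_at 0 with havoid | ⟨hP₃, hP₄⟩
  · exact (hexcl hx hy (havoid.mono hB₁c)).elim
  obtain ⟨c₁, hc₁, hp₃⟩ := hP₃.resolve_left hx0
  obtain ⟨c₂, hc₂, hp₄⟩ := hP₄.resolve_left hy0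
  obtain ⟨S₃, hS₃, hq₃, hall₃⟩ := hp₃.exists_support
  obtain ⟨S₄, hS₄, hq₄, hall₄⟩ := hp₄.exists_support
  have h34 : Disjoint S₃ S₄ := by
    rw [Set.disjoint_left]
    intro z hz₃ hz₄
    exact hexcl hx hy ((((hall₃ z hz₃).mono hS₃).trans ((hall₄ z hz₄).mono hS₄).symm).mono hB₁c)
  -- (4) truncate the four arms at `∂Λ_d`
  have hdx : (d : ℤ) ≤ triNorm (x - 0) := by
    rw [sub_zero]
    have := (abs_le_triNorm x).2.1
    rw [hx, abs_neg, abs_of_nonneg (by positivity)] at this; omega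
  have hdy : (d : ℤ) ≤ triNorm (y - 0) := by
    rw [sub_zero]
    have := (abs_le_triNorm y).2.1
    rw [hy, abs_of_nonneg (by positivity)] at this; omega
  have hda' : (d : ℤ) ≤ triNorm (a - 0) := by rwa [sub_zero]
  have hdb' : (d : ℤ) ≤ triNorm (b - 0) := by rwa [sub_zero]
  obtain ⟨e₁, he₁, ht₁⟩ := hα.exists_trunc_arm ha₁ hd hda'
  obtain ⟨e₂, he₂, ht₂⟩ := hβ.exists_trunc_arm hb₁ hd hdb'
  obtain ⟨e₃, he₃, ht₃⟩ := hq₃.symm.exists_trunc_arm hc₁ hd hdx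
  obtain ⟨e₄, he₄, ht₄⟩ := hq₄.symm.exists_trunc_arm hc₂ hd hdy
  simp only [sub_zero] at he₁ he₂ he₃ he₄ ht₁ ht₂ ht₃ ht₄
  -- closed supports inside `Λ_d` are closed sites of `P \ {0}`
  have hclosed : ∀ {S : Set (Site 2)}, S ⊆ (triSqBox L ∩ B₀ᶜ) \ {0} →
      ∀ z ∈ S ∩ {w | triNorm w ≤ d}, z ∈ P ∧ z ≠ 0 ∧ z ∉ ξ := by
    intro S hS z hz
    obtain ⟨⟨-, hzB⟩, hz0⟩ := hS hz.1
    have hzP : z ∈ P := mem_triSqBox_of_triNorm_le hz.2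
    exact ⟨hzP, hz0, fun h => hzB (Or.inr ⟨⟨hzP, hz0⟩, h⟩)⟩
  -- (5) assemble the four arms
  let T : Fin 4 → Set (Site 2) :=
    ![Sα ∩ {w | triNorm w ≤ d}, S₃ ∩ {w | triNorm w ≤ d}, Sβ ∩ {w | triNorm w ≤ d},
      S₄ ∩ {w | triNorm w ≤ d}]
  have hSαβ : ∀ z ∈ Sα, ∀ z' ∈ Sβ, z ≠ z' := by
    intro z hz z' hz' hzz'
    subst hzz'
    exact H z hz z hz' (PathIn.refl (hSα hz))
  refine mem_armEvent_of_pathIn _ T ?_ ?_ ?_ ?_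
  · -- pairwise disjoint
    have oc : ∀ {A C : Set (Site 2)}, (∀ z ∈ A, z ∈ ξ) → (∀ z ∈ C, z ∉ ξ) →
        Disjoint (A ∩ {w | triNorm w ≤ d}) C := by
      intro A C hA hC
      exact Set.disjoint_left.2 fun z hz hz' => hC z hz' (hA z hz.1)
    have co : ∀ {A C : Set (Site 2)}, (∀ z ∈ A, z ∉ ξ) → (∀ z ∈ C, z ∈ ξ) →
        Disjoint A (C ∩ {w | triNorm w ≤ d}) := by
      intro A C hA hC
      exact Set.disjoint_left.2 fun z hz hz' => hA z hz (hC z hz'.1)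
    have hα' : ∀ z ∈ Sα, z ∈ ξ := fun z hz => (hSα hz).2
    have hβ' : ∀ z ∈ Sβ, z ∈ ξ := fun z hz => (hSβ hz).2
    have h₃' : ∀ z ∈ S₃ ∩ {w | triNorm w ≤ d}, z ∉ ξ := fun z hz => (hclosed hS₃ z hz).2.2
    have h₄' : ∀ z ∈ S₄ ∩ {w | triNorm w ≤ d}, z ∉ ξ := fun z hz => (hclosed hS₄ z hz).2.2
    intro i j hij
    fin_cases i <;> fin_cases j
    · exact absurd rfl hij
    · exact oc hα' h₃'
    · exact Set.disjoint_left.2 fun z hz hz' => hSαβ z hz.1 z hz'.1 rfl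
    · exact oc hα' h₄'
    · exact (oc hα' h₃').symm
    · exact absurd rfl hij
    · exact (oc hβ' h₃').symm
    · exact Set.disjoint_left.2 fun z hz hz' => Set.disjoint_left.1 h34 hz.1 hz'.1
    · exact Set.disjoint_left.2 fun z hz hz' => hSαβ z hz'.1 z hz.1 rfl
    · exact oc hβ' h₃'
    · exact absurd rfl hij
    · exact oc hβ' h₄'
    · exact (oc hα' h₄').symm
    · exact Set.disjoint_left.2 fun z hz hz' => Set.disjoint_left.1 h34 hz'.1 hz.1
    · exact (oc hβ' h₄').symm
    · exact absurd rfl hij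
  · -- colours
    intro i z hz
    fin_cases i
    · simpa using (hSα hz.1).2
    · simpa using (hclosed hS₃ z hz).2.2
    · simpa using (hSβ hz.1).2
    · simpa using (hclosed hS₄ z hz).2.2
  · -- annulus
    have key : ∀ {S : Set (Site 2)}, (∀ z ∈ S, z ≠ (0 : Site 2)) →
        ∀ z ∈ S ∩ {w | triNorm w ≤ d}, ((1 : ℕ) : ℤ) ≤ triNorm z ∧ triNorm z ≤ d := by
      intro S hS z hz
      refine ⟨?_, hz.2⟩
      have := one_le_triNorm_sub_of_ne (hS z hz.1)
      rw [sub_zero] at this; exact_mod_cast this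
    intro i
    fin_cases i
    · exact key fun z hz => (hSα hz).1.2
    · exact key fun z hz => (hS₃ hz).2
    · exact key fun z hz => (hSβ hz).1.2
    · exact key fun z hz => (hS₄ hz).2
  · -- the arms
    have key : ∀ {S : Set (Site 2)} {u e : Site 2}, triGraph.Adj u 0 → triNorm e = d →
        PathIn triGraph (S ∩ {w | triNorm w ≤ d}) u e →
        ∃ x ∈ triSphere 1, ∃ y ∈ triSphere d, PathIn triGraph (S ∩ {w | triNorm w ≤ d}) x y := by
      intro S u e hu he hp
      refine ⟨u, ?_, e, by rwa [mem_triSphere_iff], hp⟩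
      rw [mem_triSphere_iff]
      have := triNorm_sub_eq_one_of_adj hu
      rw [sub_zero] at this; exact_mod_cast this
    intro i
    fin_cases i
    · exact key ha₁ he₁ ht₁
    · exact key hc₁ he₃ ht₃
    · exact key hb₁ he₂ ht₂
    · exact key hc₂ he₄ ht₄

end CutPoint

/-! ### Laying the wires -/

section Wires

/-- A horizontal lattice segment all of whose sites lie in `S` is a path inside `S` (rightwards,
by induction on the length). [folklore] -/
theorem pathIn_hline {S : Set (Site 2)} {u : Site 2} (n : ℕ)
    (h : ∀ z : Site 2, z 1 = u 1 → u 0 ≤ z 0 → z 0 ≤ u 0 + n → z ∈ S) :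
    ∀ w : Site 2, w 1 = u 1 → w 0 = u 0 + n → PathIn triGraph S u w := by
  induction n with
  | zero =>
    intro w hw1 hw0
    have : w = u := by rw [Site.eq_iff_two]; push_cast at hw0; omega
    subst this
    exact PathIn.refl (h _ rfl le_rfl (by push_cast; omega))
  | succ k ih =>
    intro w hw1 hw0
    let w' : Site 2 := ![w 0 - 1, w 1]
    have hw'0 : w' 0 = w 0 - 1 := rfl
    have hw'1 : w' 1 = w 1 := rfl
    have hp : PathIn triGraph S u w' :=
      ih (fun z hz1 hz2 hz3 => h z hz1 hz2 (by push_cast at hz3 ⊢; omega)) w'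
        (by rw [hw'1, hw1]) (by rw [hw'0, hw0]; push_cast; ring)
    refine hp.tail ?_ (h w hw1 (by rw [hw0]; push_cast; omega) (by rw [hw0]))
    rw [triGraph_adj_iff_coord]
    exact Or.inl ⟨by rw [hw'0]; ring, by rw [hw'1]⟩

/-- A vertical lattice segment all of whose sites lie in `S` is a path inside `S` (upwards). [folklore] -/
theorem pathIn_vline {S : Set (Site 2)} {u : Site 2} (n : ℕ)
    (h : ∀ z : Site 2, z 0 = u 0 → u 1 ≤ z 1 → z 1 ≤ u 1 + n → z ∈ S) :
    ∀ w : Site 2, w 0 = u 0 → w 1 = u 1 + n → PathIn triGraph S u w := by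
  induction n with
  | zero =>
    intro w hw0 hw1
    have : w = u := by rw [Site.eq_iff_two]; push_cast at hw1; omega
    subst this
    exact PathIn.refl (h _ rfl le_rfl (by push_cast; omega))
  | succ k ih =>
    intro w hw0 hw1
    let w' : Site 2 := ![w 0, w 1 - 1]
    have hw'0 : w' 0 = w 0 := rfl
    have hw'1 : w' 1 = w 1 - 1 := rfl
    have hp : PathIn triGraph S u w' :=
      ih (fun z hz1 hz2 hz3 => h z hz1 hz2 (by push_cast at hz3 ⊢; omega)) w'
        (by rw [hw'0, hw0]) (by rw [hw'1, hw1]; push_cast; ring)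
    refine hp.tail ?_ (h w hw0 (by rw [hw1]; push_cast; omega) (by rw [hw1]))
    rw [triGraph_adj_iff_coord]
    exact Or.inr (Or.inr (Or.inl ⟨by rw [hw'1]; ring, by rw [hw'0]⟩))

/-- A horizontal segment inside `S` joins its endpoints (either direction is obtained by `symm`). [folklore] -/
theorem pathIn_of_hseg {S : Set (Site 2)} {u w : Site 2} (h1 : w 1 = u 1) (hle : u 0 ≤ w 0)
    (h : ∀ z : Site 2, z 1 = u 1 → u 0 ≤ z 0 → z 0 ≤ w 0 → z ∈ S) : PathIn triGraph S u w := by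
  obtain ⟨n, hn⟩ : ∃ n : ℕ, w 0 = u 0 + n := ⟨(w 0 - u 0).toNat, by omega⟩
  exact pathIn_hline n (fun z hz1 hz2 hz3 => h z hz1 hz2 (by omega)) w h1 hn

/-- A vertical segment inside `S` joins its endpoints. [folklore] -/
theorem pathIn_of_vseg {S : Set (Site 2)} {u w : Site 2} (h0 : w 0 = u 0) (hle : u 1 ≤ w 1)
    (h : ∀ z : Site 2, z 0 = u 0 → u 1 ≤ z 1 → z 1 ≤ w 1 → z ∈ S) : PathIn triGraph S u w := by
  obtain ⟨n, hn⟩ : ∃ n : ℕ, w 1 = u 1 + n := ⟨(w 1 - u 1).toNat, by omega⟩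
  exact pathIn_vline n (fun z hz1 hz2 hz3 => h z hz1 hz2 (by omega)) w h0 hn

variable {d : ℕ} {a b : Site 2}

/-- **The wire of `a`** (on the right side of `P = [-d, d]²`, `a = (d, r)`): the horizontal segment
`{(x, r) | d + 1 ≤ x ≤ d + 3}`; it touches `P` only at `a` and at `(d, r + 1)` (when in `P`), and
reaches the right side of `P⁺ = [-d-3, d+3]²`. Packaged existentially with its attaching
neighbour and its specification. [folklore] -/
theorem exists_wireA (ha0 : a 0 = d) (ha1 : |a 1| ≤ d) :
    ∃ (a' : Site 2) (Wa : Set (Site 2)),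
      Wa ⊆ triSqBox (d + 3) ∧ (∀ z ∈ Wa, z ∉ triSqBox d) ∧ a' ∈ triSqBox d ∧ (a' = a ∨ triGraph.Adj a a') ∧
      (∀ p ∈ Wa, ∀ q ∈ triSqBox d, triGraph.Adj p q → q = a ∨ q = a') ∧
      (∀ z ∈ Wa, z 0 ≠ -((d : ℤ) + 3)) ∧
      (∃ e ∈ Wa, e 0 = (d : ℤ) + 3 ∧ PathIn triGraph (insert a Wa) a e) ∧
      (∀ z ∈ Wa, z 1 = a 1 ∧ (d : ℤ) + 1 ≤ z 0 ∧ z 0 ≤ (d : ℤ) + 3) := by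
  rw [abs_le] at ha1
  set Wa : Set (Site 2) := {z | z 1 = a 1 ∧ (d : ℤ) + 1 ≤ z 0 ∧ z 0 ≤ (d : ℤ) + 3} with hWa
  have hmem : ∀ {z : Site 2}, z ∈ Wa ↔ z 1 = a 1 ∧ (d : ℤ) + 1 ≤ z 0 ∧ z 0 ≤ (d : ℤ) + 3 :=
    fun {z} => Iff.rfl
  set a' : Site 2 := ![(d : ℤ), min (a 1 + 1) d] with ha'
  have ha'0 : a' 0 = d := rfl
  have ha'1 : a' 1 = min (a 1 + 1) d := rfl
  refine ⟨a', Wa, ?_, ?_, ?_, ?_, ?_, ?_, ?_, fun z hz => hz⟩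
  · intro z hz; rw [hmem] at hz; rw [mem_triSqBox, abs_le, abs_le]; omega
  · intro z hz hz'; rw [hmem] at hz; rw [mem_triSqBox, abs_le] at hz'; omega
  · rw [mem_triSqBox, ha'0, ha'1, abs_le, abs_le]; omega
  · by_cases h : a 1 + 1 ≤ d
    · right; rw [triGraph_adj_iff_coord, ha'0, ha'1]; omega
    · left; rw [Site.eq_iff_two, ha'0, ha'1]; omega
  · intro p hp q hq hpq
    rw [hmem] at hp
    rw [mem_triSqBox, abs_le, abs_le] at hq
    rw [triGraph_adj_iff_coord] at hpq
    rw [Site.eq_iff_two, Site.eq_iff_two, ha'0, ha'1]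
    omega
  · intro z hz; rw [hmem] at hz; omega
  · refine ⟨![(d : ℤ) + 3, a 1], ?_, rfl, ?_⟩
    · rw [hmem]; exact ⟨rfl, by show (d : ℤ) + 1 ≤ (d : ℤ) + 3 ∧ (d : ℤ) + 3 ≤ (d : ℤ) + 3; omega⟩
    · refine pathIn_of_hseg rfl (by show a 0 ≤ (d : ℤ) + 3; omega) fun z hz1 hz2 hz3 => ?_
      change z 0 ≤ (d : ℤ) + 3 at hz3
      rcases eq_or_lt_of_le hz2 with h | h
      · left; rw [Site.eq_iff_two]; omega
      · right; rw [hmem]; omega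

/-- The specification of the wire of `b` relative to the data of the wire of `a`, as needed by
`CutPointWires` (an abbreviation of the proof obligations of the five cases). [folklore] -/
theorem cutPointWires_of_specs {a' b' : Site 2} {Wa Wb : Set (Site 2)}
    (hA : Wa ⊆ triSqBox (d + 3) ∧ (∀ z ∈ Wa, z ∉ triSqBox d) ∧ a' ∈ triSqBox d ∧ (a' = a ∨ triGraph.Adj a a') ∧
      (∀ p ∈ Wa, ∀ q ∈ triSqBox d, triGraph.Adj p q → q = a ∨ q = a') ∧
      (∀ z ∈ Wa, z 0 ≠ -((d : ℤ) + 3)) ∧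
      (∃ e ∈ Wa, e 0 = (d : ℤ) + 3 ∧ PathIn triGraph (insert a Wa) a e) ∧
      (∀ z ∈ Wa, z 1 = a 1 ∧ (d : ℤ) + 1 ≤ z 0 ∧ z 0 ≤ (d : ℤ) + 3))
    (hB1 : Wb ⊆ triSqBox (d + 3)) (hB2 : ∀ z ∈ Wb, z ∉ triSqBox d) (hB3 : b' ∈ triSqBox d)
    (hB4 : b' = b ∨ triGraph.Adj b b')
    (hB5 : ∀ p ∈ Wb, ∀ q ∈ triSqBox d, triGraph.Adj p q → q = b ∨ q = b')
    (hB6 : ∀ p ∈ Wa, ∀ q ∈ Wb, ¬ triGraph.Adj p q) (hB7 : Disjoint Wa Wb)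
    (hB8 : ∀ z ∈ Wb, z 0 ≠ (d : ℤ) + 3)
    (hB9 : ∃ e ∈ Wb, e 0 = -((d : ℤ) + 3) ∧ PathIn triGraph (insert b Wb) b e) :
    CutPointWires d a a' b b' Wa Wb :=
  ⟨hA.1, hB1, hA.2.1, hB2, hA.2.2.1, hB3, hA.2.2.2.1, hB4, hA.2.2.2.2.1, hB5, hB6, hB7, hA.2.2.2.2.2.1,
    hB8, hA.2.2.2.2.2.2.1, hB9⟩

/-- Wires when `b` lies on the **left side** of `P`: the horizontal segment
`{(x, b₁) | -d-3 ≤ x ≤ -d-1}`. [folklore] -/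
theorem exists_cutPointWires_left (ha0 : a 0 = d) (ha1 : |a 1| ≤ d) (hb0 : b 0 = -(d : ℤ))
    (hb1 : |b 1| ≤ d) : ∃ a' b' Wa Wb, CutPointWires d a a' b b' Wa Wb := by
  obtain ⟨a', Wa, hA⟩ := exists_wireA ha0 ha1
  have hWa := hA.2.2.2.2.2.2.2
  rw [abs_le] at ha1 hb1
  set Wb : Set (Site 2) := {z | z 1 = b 1 ∧ -((d : ℤ) + 3) ≤ z 0 ∧ z 0 ≤ -((d : ℤ) + 1)} with hWb
  have hmem : ∀ {z : Site 2}, z ∈ Wb ↔ z 1 = b 1 ∧ -((d : ℤ) + 3) ≤ z 0 ∧ z 0 ≤ -((d : ℤ) + 1) :=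
    fun {z} => Iff.rfl
  set b' : Site 2 := ![-(d : ℤ), max (b 1 - 1) (-(d : ℤ))] with hb'
  have hb'0 : b' 0 = -(d : ℤ) := rfl
  have hb'1 : b' 1 = max (b 1 - 1) (-(d : ℤ)) := rfl
  refine ⟨a', b', Wa, Wb, cutPointWires_of_specs hA ?_ ?_ ?_ ?_ ?_ ?_ ?_ ?_ ?_⟩
  · intro z hz; rw [hmem] at hz; rw [mem_triSqBox, abs_le, abs_le]; omega
  · intro z hz hz'; rw [hmem] at hz; rw [mem_triSqBox, abs_le] at hz'; omega
  · rw [mem_triSqBox, hb'0, hb'1, abs_le, abs_le]; omega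
  · by_cases h : -(d : ℤ) ≤ b 1 - 1
    · right; rw [triGraph_adj_iff_coord, hb'0, hb'1]; omega
    · left; rw [Site.eq_iff_two, hb'0, hb'1]; omega
  · intro p hp q hq hpq
    rw [hmem] at hp
    rw [mem_triSqBox, abs_le, abs_le] at hq
    rw [triGraph_adj_iff_coord] at hpq
    rw [Site.eq_iff_two, Site.eq_iff_two, hb'0, hb'1]
    omega
  · intro p hp q hq hpq
    obtain ⟨-, hp0, -⟩ := hWa p hp
    rw [hmem] at hq
    rw [triGraph_adj_iff_coord] at hpq
    omega
  · rw [Set.disjoint_left]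
    intro z hz hz'
    obtain ⟨-, hz0, -⟩ := hWa z hz
    rw [hmem] at hz'
    omega
  · intro z hz; rw [hmem] at hz; omega
  · refine ⟨![-((d : ℤ) + 3), b 1], ?_, rfl, ?_⟩
    · rw [hmem]
      exact ⟨rfl, by show -((d : ℤ) + 3) ≤ -((d : ℤ) + 3) ∧ -((d : ℤ) + 3) ≤ -((d : ℤ) + 1); omega⟩
    · refine (pathIn_of_hseg (u := ![-((d : ℤ) + 3), b 1]) (w := b) rfl
        (by show -((d : ℤ) + 3) ≤ b 0; omega) fun z hz1 hz2 hz3 => ?_).symm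
      change z 1 = b 1 at hz1
      change -((d : ℤ) + 3) ≤ z 0 at hz2
      rcases eq_or_lt_of_le hz3 with h | h
      · left; rw [Site.eq_iff_two]; omega
      · right; rw [hmem]; omega

/-- Wires when `b` lies on the **top side** of `P`: up from `b` to the top side of `P⁺`, then along
it to the top-left corner. [folklore] -/
theorem exists_cutPointWires_top (ha0 : a 0 = d) (ha1 : |a 1| ≤ d) (hb1 : b 1 = (d : ℤ))
    (hb0 : |b 0| ≤ d) (hab : a ≠ b) : ∃ a' b' Wa Wb, CutPointWires d a a' b b' Wa Wb := by
  obtain ⟨a', Wa, hA⟩ := exists_wireA ha0 ha1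
  have hWa := hA.2.2.2.2.2.2.2
  rw [abs_le] at ha1 hb0
  have hne : ¬ (b 0 = d ∧ a 1 = d) := by
    rintro ⟨h1, h2⟩; apply hab; rw [Site.eq_iff_two]; omega
  set Wb : Set (Site 2) := {z | (z 0 = b 0 ∧ (d : ℤ) + 1 ≤ z 1 ∧ z 1 ≤ (d : ℤ) + 3) ∨
    (z 1 = (d : ℤ) + 3 ∧ -((d : ℤ) + 3) ≤ z 0 ∧ z 0 ≤ b 0)} with hWb
  have hmem : ∀ {z : Site 2}, z ∈ Wb ↔ (z 0 = b 0 ∧ (d : ℤ) + 1 ≤ z 1 ∧ z 1 ≤ (d : ℤ) + 3) ∨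
      (z 1 = (d : ℤ) + 3 ∧ -((d : ℤ) + 3) ≤ z 0 ∧ z 0 ≤ b 0) := fun {z} => Iff.rfl
  set b' : Site 2 := ![min (b 0 + 1) d, (d : ℤ)] with hb'
  have hb'0 : b' 0 = min (b 0 + 1) d := rfl
  have hb'1 : b' 1 = (d : ℤ) := rfl
  refine ⟨a', b', Wa, Wb, cutPointWires_of_specs hA ?_ ?_ ?_ ?_ ?_ ?_ ?_ ?_ ?_⟩
  · intro z hz; rw [hmem] at hz; rw [mem_triSqBox, abs_le, abs_le]; omega
  · intro z hz hz'; rw [hmem] at hz; rw [mem_triSqBox, abs_le, abs_le] at hz'; omega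
  · rw [mem_triSqBox, hb'0, hb'1, abs_le, abs_le]; omega
  · by_cases h : b 0 + 1 ≤ d
    · right; rw [triGraph_adj_iff_coord, hb'0, hb'1]; omega
    · left; rw [Site.eq_iff_two, hb'0, hb'1]; omega
  · intro p hp q hq hpq
    rw [hmem] at hp
    rw [mem_triSqBox, abs_le, abs_le] at hq
    rw [triGraph_adj_iff_coord] at hpq
    rw [Site.eq_iff_two, Site.eq_iff_two, hb'0, hb'1]
    omega
  · intro p hp q hq hpq
    obtain ⟨hp1, hp0, -⟩ := hWa p hp
    rw [hmem] at hq
    rw [triGraph_adj_iff_coord] at hpq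
    omega
  · rw [Set.disjoint_left]
    intro z hz hz'
    obtain ⟨hz1, hz0, -⟩ := hWa z hz
    rw [hmem] at hz'
    omega
  · intro z hz; rw [hmem] at hz; omega
  · refine ⟨![-((d : ℤ) + 3), (d : ℤ) + 3], ?_, rfl, ?_⟩
    · rw [hmem]; right
      exact ⟨rfl, by show -((d : ℤ) + 3) ≤ -((d : ℤ) + 3) ∧ -((d : ℤ) + 3) ≤ b 0; omega⟩
    · -- up from `b` to `(b₀, d + 3)`, then left along the top side of `P⁺`
      have h1 : PathIn triGraph (insert b Wb) b ![b 0, (d : ℤ) + 3] := by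
        refine pathIn_of_vseg rfl (by show b 1 ≤ (d : ℤ) + 3; omega) fun z hz0 hz1 hz2 => ?_
        change z 1 ≤ (d : ℤ) + 3 at hz2
        rcases eq_or_lt_of_le hz1 with h | h
        · left; rw [Site.eq_iff_two]; omega
        · right; rw [hmem]; omega
      refine h1.trans (pathIn_of_hseg (u := ![-((d : ℤ) + 3), (d : ℤ) + 3])
        (w := ![b 0, (d : ℤ) + 3]) rfl
        (by show -((d : ℤ) + 3) ≤ b 0; omega) fun z hz1 hz2 hz3 => ?_).symm
      change z 1 = (d : ℤ) + 3 at hz1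
      change -((d : ℤ) + 3) ≤ z 0 at hz2
      change z 0 ≤ b 0 at hz3
      right; rw [hmem]; omega

/-- Wires when `b` lies on the **bottom side** of `P`: down from `b` to the bottom side of `P⁺`,
then along it to the bottom-left corner. [folklore] -/
theorem exists_cutPointWires_bottom (ha0 : a 0 = d) (ha1 : |a 1| ≤ d) (hb1 : b 1 = -(d : ℤ))
    (hb0 : |b 0| ≤ d) : ∃ a' b' Wa Wb, CutPointWires d a a' b b' Wa Wb := by
  obtain ⟨a', Wa, hA⟩ := exists_wireA ha0 ha1
  have hWa := hA.2.2.2.2.2.2.2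
  rw [abs_le] at ha1 hb0
  set Wb : Set (Site 2) := {z | (z 0 = b 0 ∧ -((d : ℤ) + 3) ≤ z 1 ∧ z 1 ≤ -((d : ℤ) + 1)) ∨
    (z 1 = -((d : ℤ) + 3) ∧ -((d : ℤ) + 3) ≤ z 0 ∧ z 0 ≤ b 0)} with hWb
  have hmem : ∀ {z : Site 2}, z ∈ Wb ↔ (z 0 = b 0 ∧ -((d : ℤ) + 3) ≤ z 1 ∧ z 1 ≤ -((d : ℤ) + 1)) ∨
      (z 1 = -((d : ℤ) + 3) ∧ -((d : ℤ) + 3) ≤ z 0 ∧ z 0 ≤ b 0) := fun {z} => Iff.rfl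
  set b' : Site 2 := ![max (b 0 - 1) (-(d : ℤ)), -(d : ℤ)] with hb'
  have hb'0 : b' 0 = max (b 0 - 1) (-(d : ℤ)) := rfl
  have hb'1 : b' 1 = -(d : ℤ) := rfl
  refine ⟨a', b', Wa, Wb, cutPointWires_of_specs hA ?_ ?_ ?_ ?_ ?_ ?_ ?_ ?_ ?_⟩
  · intro z hz; rw [hmem] at hz; rw [mem_triSqBox, abs_le, abs_le]; omega
  · intro z hz hz'; rw [hmem] at hz; rw [mem_triSqBox, abs_le, abs_le] at hz'; omega
  · rw [mem_triSqBox, hb'0, hb'1, abs_le, abs_le]; omega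
  · by_cases h : -(d : ℤ) ≤ b 0 - 1
    · right; rw [triGraph_adj_iff_coord, hb'0, hb'1]; omega
    · left; rw [Site.eq_iff_two, hb'0, hb'1]; omega
  · intro p hp q hq hpq
    rw [hmem] at hp
    rw [mem_triSqBox, abs_le, abs_le] at hq
    rw [triGraph_adj_iff_coord] at hpq
    rw [Site.eq_iff_two, Site.eq_iff_two, hb'0, hb'1]
    omega
  · intro p hp q hq hpq
    obtain ⟨hp1, hp0, -⟩ := hWa p hp
    rw [hmem] at hq
    rw [triGraph_adj_iff_coord] at hpq
    omega
  · rw [Set.disjoint_left]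
    intro z hz hz'
    obtain ⟨hz1, hz0, -⟩ := hWa z hz
    rw [hmem] at hz'
    omega
  · intro z hz; rw [hmem] at hz; omega
  · refine ⟨![-((d : ℤ) + 3), -((d : ℤ) + 3)], ?_, rfl, ?_⟩
    · rw [hmem]; right
      exact ⟨rfl, by show -((d : ℤ) + 3) ≤ -((d : ℤ) + 3) ∧ -((d : ℤ) + 3) ≤ b 0; omega⟩
    · -- down from `b` to `(b₀, -d - 3)`, then left along the bottom side of `P⁺`
      have h1 : PathIn triGraph (insert b Wb) b ![b 0, -((d : ℤ) + 3)] := by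
        refine (pathIn_of_vseg (u := ![b 0, -((d : ℤ) + 3)]) (w := b) rfl
          (by show -((d : ℤ) + 3) ≤ b 1; omega) fun z hz0 hz1 hz2 => ?_).symm
        change z 0 = b 0 at hz0
        change -((d : ℤ) + 3) ≤ z 1 at hz1
        rcases eq_or_lt_of_le hz2 with h | h
        · left; rw [Site.eq_iff_two]; omega
        · right; rw [hmem]; omega
      refine h1.trans (pathIn_of_hseg (u := ![-((d : ℤ) + 3), -((d : ℤ) + 3)])
        (w := ![b 0, -((d : ℤ) + 3)]) rfl
        (by show -((d : ℤ) + 3) ≤ b 0; omega) fun z hz1 hz2 hz3 => ?_).symm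
      change z 1 = -((d : ℤ) + 3) at hz1
      change -((d : ℤ) + 3) ≤ z 0 at hz2
      change z 0 ≤ b 0 at hz3
      right; rw [hmem]; omega

/-- Wires when `b` lies on the **right side** of `P`, **below** `a` (`b₁ ≤ a₁ - 2`): two steps to
the right, down the column `x = d + 2` to the bottom side of `P⁺`, then along it to the
bottom-left corner. [folklore] -/
theorem exists_cutPointWires_right_below (ha0 : a 0 = d) (ha1 : |a 1| ≤ d) (hb0 : b 0 = (d : ℤ))
    (hb1 : |b 1| ≤ d) (hlt : b 1 + 2 ≤ a 1) : ∃ a' b' Wa Wb, CutPointWires d a a' b b' Wa Wb := by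
  obtain ⟨a', Wa, hA⟩ := exists_wireA ha0 ha1
  have hWa := hA.2.2.2.2.2.2.2
  rw [abs_le] at ha1 hb1
  set Wb : Set (Site 2) := {z | (z 1 = b 1 ∧ (d : ℤ) + 1 ≤ z 0 ∧ z 0 ≤ (d : ℤ) + 2) ∨
    (z 0 = (d : ℤ) + 2 ∧ -((d : ℤ) + 3) ≤ z 1 ∧ z 1 ≤ b 1) ∨
    (z 1 = -((d : ℤ) + 3) ∧ -((d : ℤ) + 3) ≤ z 0 ∧ z 0 ≤ (d : ℤ) + 2)} with hWb
  have hmem : ∀ {z : Site 2}, z ∈ Wb ↔ (z 1 = b 1 ∧ (d : ℤ) + 1 ≤ z 0 ∧ z 0 ≤ (d : ℤ) + 2) ∨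
      (z 0 = (d : ℤ) + 2 ∧ -((d : ℤ) + 3) ≤ z 1 ∧ z 1 ≤ b 1) ∨
      (z 1 = -((d : ℤ) + 3) ∧ -((d : ℤ) + 3) ≤ z 0 ∧ z 0 ≤ (d : ℤ) + 2) := fun {z} => Iff.rfl
  set b' : Site 2 := ![(d : ℤ), b 1 + 1] with hb'
  have hb'0 : b' 0 = (d : ℤ) := rfl
  have hb'1 : b' 1 = b 1 + 1 := rfl
  refine ⟨a', b', Wa, Wb, cutPointWires_of_specs hA ?_ ?_ ?_ ?_ ?_ ?_ ?_ ?_ ?_⟩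
  · intro z hz; rw [hmem] at hz; rw [mem_triSqBox, abs_le, abs_le]; omega
  · intro z hz hz'; rw [hmem] at hz; rw [mem_triSqBox, abs_le, abs_le] at hz'; omega
  · rw [mem_triSqBox, hb'0, hb'1, abs_le, abs_le]; omega
  · right; rw [triGraph_adj_iff_coord, hb'0, hb'1]; omega
  · intro p hp q hq hpq
    rw [hmem] at hp
    rw [mem_triSqBox, abs_le, abs_le] at hq
    rw [triGraph_adj_iff_coord] at hpq
    rw [Site.eq_iff_two, Site.eq_iff_two, hb'0, hb'1]
    omega
  · intro p hp q hq hpq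
    obtain ⟨hp1, hp0, -⟩ := hWa p hp
    rw [hmem] at hq
    rw [triGraph_adj_iff_coord] at hpq
    omega
  · rw [Set.disjoint_left]
    intro z hz hz'
    obtain ⟨hz1, hz0, -⟩ := hWa z hz
    rw [hmem] at hz'
    omega
  · intro z hz; rw [hmem] at hz; omega
  · refine ⟨![-((d : ℤ) + 3), -((d : ℤ) + 3)], ?_, rfl, ?_⟩
    · rw [hmem]; right; right
      exact ⟨rfl, by show -((d : ℤ) + 3) ≤ -((d : ℤ) + 3) ∧ -((d : ℤ) + 3) ≤ (d : ℤ) + 2; omega⟩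
    · -- right from `b` to `(d + 2, b₁)`, down to `(d + 2, -d - 3)`, left to the corner
      have h1 : PathIn triGraph (insert b Wb) b ![(d : ℤ) + 2, b 1] := by
        refine pathIn_of_hseg rfl (by show b 0 ≤ (d : ℤ) + 2; omega) fun z hz1 hz2 hz3 => ?_
        change z 0 ≤ (d : ℤ) + 2 at hz3
        rcases eq_or_lt_of_le hz2 with h | h
        · left; rw [Site.eq_iff_two]; omega
        · right; rw [hmem]; omega
      have h2 : PathIn triGraph (insert b Wb) ![(d : ℤ) + 2, b 1] ![(d : ℤ) + 2, -((d : ℤ) + 3)] := by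
        refine (pathIn_of_vseg (u := ![(d : ℤ) + 2, -((d : ℤ) + 3)]) (w := ![(d : ℤ) + 2, b 1]) rfl
          (by show -((d : ℤ) + 3) ≤ b 1; omega) fun z hz0 hz1 hz2 => ?_).symm
        change z 0 = (d : ℤ) + 2 at hz0
        change -((d : ℤ) + 3) ≤ z 1 at hz1
        change z 1 ≤ b 1 at hz2
        right; rw [hmem]; omega
      refine (h1.trans h2).trans (pathIn_of_hseg (u := ![-((d : ℤ) + 3), -((d : ℤ) + 3)])
        (w := ![(d : ℤ) + 2, -((d : ℤ) + 3)]) rfl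
        (by show -((d : ℤ) + 3) ≤ (d : ℤ) + 2; omega) fun z hz1 hz2 hz3 => ?_).symm
      change z 1 = -((d : ℤ) + 3) at hz1
      change -((d : ℤ) + 3) ≤ z 0 at hz2
      change z 0 ≤ (d : ℤ) + 2 at hz3
      right; rw [hmem]; omega

/-- Wires when `b` lies on the **right side** of `P`, **above** `a` (`a₁ + 2 ≤ b₁`): two steps to
the right, up the column `x = d + 2` to the top side of `P⁺`, then along it to the top-left
corner. [folklore] -/
theorem exists_cutPointWires_right_above (ha0 : a 0 = d) (ha1 : |a 1| ≤ d) (hb0 : b 0 = (d : ℤ))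
    (hb1 : |b 1| ≤ d) (hlt : a 1 + 2 ≤ b 1) : ∃ a' b' Wa Wb, CutPointWires d a a' b b' Wa Wb := by
  obtain ⟨a', Wa, hA⟩ := exists_wireA ha0 ha1
  have hWa := hA.2.2.2.2.2.2.2
  rw [abs_le] at ha1 hb1
  set Wb : Set (Site 2) := {z | (z 1 = b 1 ∧ (d : ℤ) + 1 ≤ z 0 ∧ z 0 ≤ (d : ℤ) + 2) ∨
    (z 0 = (d : ℤ) + 2 ∧ b 1 ≤ z 1 ∧ z 1 ≤ (d : ℤ) + 3) ∨
    (z 1 = (d : ℤ) + 3 ∧ -((d : ℤ) + 3) ≤ z 0 ∧ z 0 ≤ (d : ℤ) + 2)} with hWb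
  have hmem : ∀ {z : Site 2}, z ∈ Wb ↔ (z 1 = b 1 ∧ (d : ℤ) + 1 ≤ z 0 ∧ z 0 ≤ (d : ℤ) + 2) ∨
      (z 0 = (d : ℤ) + 2 ∧ b 1 ≤ z 1 ∧ z 1 ≤ (d : ℤ) + 3) ∨
      (z 1 = (d : ℤ) + 3 ∧ -((d : ℤ) + 3) ≤ z 0 ∧ z 0 ≤ (d : ℤ) + 2) := fun {z} => Iff.rfl
  set b' : Site 2 := ![(d : ℤ), min (b 1 + 1) d] with hb'
  have hb'0 : b' 0 = (d : ℤ) := rfl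
  have hb'1 : b' 1 = min (b 1 + 1) d := rfl
  refine ⟨a', b', Wa, Wb, cutPointWires_of_specs hA ?_ ?_ ?_ ?_ ?_ ?_ ?_ ?_ ?_⟩
  · intro z hz; rw [hmem] at hz; rw [mem_triSqBox, abs_le, abs_le]; omega
  · intro z hz hz'; rw [hmem] at hz; rw [mem_triSqBox, abs_le, abs_le] at hz'; omega
  · rw [mem_triSqBox, hb'0, hb'1, abs_le, abs_le]; omega
  · by_cases h : b 1 + 1 ≤ d
    · right; rw [triGraph_adj_iff_coord, hb'0, hb'1]; omega
    · left; rw [Site.eq_iff_two, hb'0, hb'1]; omega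
  · intro p hp q hq hpq
    rw [hmem] at hp
    rw [mem_triSqBox, abs_le, abs_le] at hq
    rw [triGraph_adj_iff_coord] at hpq
    rw [Site.eq_iff_two, Site.eq_iff_two, hb'0, hb'1]
    omega
  · intro p hp q hq hpq
    obtain ⟨hp1, hp0, -⟩ := hWa p hp
    rw [hmem] at hq
    rw [triGraph_adj_iff_coord] at hpq
    omega
  · rw [Set.disjoint_left]
    intro z hz hz'
    obtain ⟨hz1, hz0, -⟩ := hWa z hz
    rw [hmem] at hz'
    omega
  · intro z hz; rw [hmem] at hz; omega
  · refine ⟨![-((d : ℤ) + 3), (d : ℤ) + 3], ?_, rfl, ?_⟩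
    · rw [hmem]; right; right
      exact ⟨rfl, by show -((d : ℤ) + 3) ≤ -((d : ℤ) + 3) ∧ -((d : ℤ) + 3) ≤ (d : ℤ) + 2; omega⟩
    · have h1 : PathIn triGraph (insert b Wb) b ![(d : ℤ) + 2, b 1] := by
        refine pathIn_of_hseg rfl (by show b 0 ≤ (d : ℤ) + 2; omega) fun z hz1 hz2 hz3 => ?_
        change z 0 ≤ (d : ℤ) + 2 at hz3
        rcases eq_or_lt_of_le hz2 with h | h
        · left; rw [Site.eq_iff_two]; omega
        · right; rw [hmem]; omega
      have h2 : PathIn triGraph (insert b Wb) ![(d : ℤ) + 2, b 1] ![(d : ℤ) + 2, (d : ℤ) + 3] := by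
        refine pathIn_of_vseg rfl (by show b 1 ≤ (d : ℤ) + 3; omega) fun z hz0 hz1 hz2 => ?_
        change z 0 = (d : ℤ) + 2 at hz0
        change b 1 ≤ z 1 at hz1
        change z 1 ≤ (d : ℤ) + 3 at hz2
        right; rw [hmem]; omega
      refine (h1.trans h2).trans (pathIn_of_hseg (u := ![-((d : ℤ) + 3), (d : ℤ) + 3])
        (w := ![(d : ℤ) + 2, (d : ℤ) + 3]) rfl
        (by show -((d : ℤ) + 3) ≤ (d : ℤ) + 2; omega) fun z hz1 hz2 hz3 => ?_).symm
      change z 1 = (d : ℤ) + 3 at hz1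
      change -((d : ℤ) + 3) ≤ z 0 at hz2
      change z 0 ≤ (d : ℤ) + 2 at hz3
      right; rw [hmem]; omega

/-- **Wires exist** for `a` on the right side of `P = [-d, d]²` and `b` any boundary site of `P`
different from and not adjacent to `a` (dispatch on the side of `b`). [folklore] -/
theorem exists_cutPointWires (ha0 : a 0 = d) (ha1 : |a 1| ≤ d) (hb : b ∈ triSqBox d)
    (hbd : |b 0| = d ∨ |b 1| = d) (hab : a ≠ b) (hab' : ¬ triGraph.Adj a b) :
    ∃ a' b' Wa Wb, CutPointWires d a a' b b' Wa Wb := by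
  rw [mem_triSqBox] at hb
  obtain ⟨hb0, hb1⟩ := hb
  by_cases hL : b 0 = -(d : ℤ)
  · exact exists_cutPointWires_left ha0 ha1 hL hb1
  by_cases hT : b 1 = (d : ℤ)
  · exact exists_cutPointWires_top ha0 ha1 hT hb0 hab
  by_cases hB : b 1 = -(d : ℤ)
  · exact exists_cutPointWires_bottom ha0 ha1 hB hb0
  have hR : b 0 = (d : ℤ) := by
    rw [abs_le] at hb0 hb1
    rcases hbd with h | h
    · rw [abs_eq (by positivity)] at h; tauto
    · rw [abs_eq (by positivity)] at h; tauto
  have hne : a 1 ≠ b 1 := by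
    intro h; apply hab; rw [Site.eq_iff_two]; exact ⟨by rw [ha0, hR], h⟩
  have hnadj : ¬ (a 1 + 1 = b 1 ∨ b 1 + 1 = a 1) := by
    intro h; apply hab'; rw [triGraph_adj_iff_coord]; omega
  rcases lt_or_gt_of_ne hne with h | h
  · exact exists_cutPointWires_right_above ha0 ha1 hR hb1 (by omega)
  · exact exists_cutPointWires_right_below ha0 ha1 hR hb1 (by omega)

end Wires

/-! ### The cut-point lemma -/

section CutPointMain

variable {d : ℕ} {ξ : SiteConfig (Site 2)} {Sα Sβ : Set (Site 2)} {a₁ a b₁ b : Site 2}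

/-- **The cut-point lemma, `a` on the right side of `P`.** See the module docstring; the
hypotheses `a ≠ b`, `a ≁ b` of the wires follow from the cut-point hypothesis `H`. [cite: Nolin2008, §6.2, proof of Thm. 27, Case 1 (arXiv 0711.4948: Thm. 26, Fig. 8)] [cite: BollobasRiordan2006, Ch. 5 Lemma 7] -/
theorem armEvent_of_cutPoint_right (hd : 1 ≤ d) (hSα : Sα ⊆ (triSqBox d \ {0}) ∩ ξ)
    (hSβ : Sβ ⊆ (triSqBox d \ {0}) ∩ ξ) (ha₁ : triGraph.Adj a₁ 0) (hb₁ : triGraph.Adj b₁ 0)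
    (hα : PathIn triGraph Sα a₁ a) (hβ : PathIn triGraph Sβ b₁ b) (ha0 : a 0 = d)
    (hbd : |b 0| = d ∨ |b 1| = d)
    (H : ∀ z ∈ Sα, ∀ z' ∈ Sβ, ¬ PathIn triGraph ((triSqBox d \ {0}) ∩ ξ) z z') :
    ξ ∈ armEvent ![true, false, true, false] 1 d := by
  have haP : a ∈ triSqBox d := (hSα hα.right_mem).1.1
  have hbP : b ∈ triSqBox d := (hSβ hβ.right_mem).1.1
  have ha1 : |a 1| ≤ d := (mem_triSqBox.1 haP).2
  have hab : a ≠ b := by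
    intro h
    have haα : a ∈ Sα := hα.right_mem
    rw [h] at haα
    exact H b haα b hβ.right_mem (PathIn.refl (hSβ hβ.right_mem))
  have hab' : ¬ triGraph.Adj a b := fun h =>
    H a hα.right_mem b hβ.right_mem (PathIn.of_adj (hSα hα.right_mem) (hSβ hβ.right_mem) h)
  obtain ⟨a', b', Wa, Wb, hW⟩ := exists_cutPointWires ha0 ha1 hbP hbd hab hab'
  have hda : (d : ℤ) ≤ triNorm a := by
    have := (abs_le_triNorm a).1; rw [ha0, abs_of_nonneg (by positivity)] at this; exact this
  have hdb : (d : ℤ) ≤ triNorm b := by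
    rcases hbd with h | h
    · have := (abs_le_triNorm b).1; rw [h] at this; exact this
    · have := (abs_le_triNorm b).2.1; rw [h] at this; exact this
  exact armEvent_of_cutPoint_of_wires hd hW hSα hSβ ha₁ hb₁ hα hβ hda hdb H

end CutPointMain

/-! ### Symmetries: transporting the cut-point lemma -/

section Symmetry

/-- `triNorm` is invariant under the transposition `(z₀, z₁) ↦ (z₁, z₀)`. [folklore] -/
theorem triNorm_transposeIso (z : Site 2) : triNorm (transposeIso z) = triNorm z := by
  simp only [triNorm, transposeIso_apply_zero, transposeIso_apply_one]
  rw [add_comm (z 1) (z 0), max_left_comm]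

/-- The triangle inequality for `triNorm`. [folklore] -/
theorem triNorm_add_le (x y : Site 2) : triNorm (x + y) ≤ triNorm x + triNorm y := by
  obtain ⟨hx0, hx1, hx2⟩ := triNorm_le_iff.1 (le_refl (triNorm x))
  obtain ⟨hy0, hy1, hy2⟩ := triNorm_le_iff.1 (le_refl (triNorm y))
  rw [triNorm_le_iff]
  simp only [Pi.add_apply, abs_le] at *
  omega

/-- `triNorm` is at most the `ℓ¹`-norm of the two coordinates. [folklore] -/
theorem triNorm_le_abs_add_abs (z : Site 2) : triNorm z ≤ |z 0| + |z 1| := by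
  rw [triNorm_le_iff]
  refine ⟨le_add_of_nonneg_right (abs_nonneg _), le_add_of_nonneg_left (abs_nonneg _), abs_add_le _ _⟩

/-- **Arm events are invariant under the norm-preserving automorphisms of `𝕋`** (pull-back form):
if `φ` is an automorphism of `𝕋` preserving `triNorm` and the relabelled configuration `φ(ξ)` has
the arms, so does `ξ` (map the arms by `φ⁻¹`). [cite: SmirnovWernerMRL2001, Rem. 2] -/
theorem mem_armEvent_of_relabel_iso {k : ℕ} (κ : Fin k → Bool) {r R : ℕ}
    (φ : triGraph ≃g triGraph) (hφn : ∀ z, triNorm (φ z) = triNorm z) {ξ : SiteConfig (Site 2)}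
    (h : SiteConfig.relabel φ.toEquiv ξ ∈ armEvent κ r R) : ξ ∈ armEvent κ r R := by
  classical
  obtain ⟨x, y, w, hw, hdisj⟩ := h
  have hψn : ∀ z, triNorm (φ.symm z) = triNorm z := fun z => by
    have := hφn (φ.symm z); rw [RelIso.apply_symm_apply] at this; exact this.symm
  set f : triGraph →g triGraph := φ.symm.toEmbedding.toHom with hf
  have hfapp : ∀ z, f z = φ.symm z := fun z => rfl
  have hmemξ : ∀ z, z ∈ SiteConfig.relabel φ.toEquiv ξ ↔ φ.symm z ∈ ξ := fun z =>
    SiteConfig.mem_relabel_iff _ _ _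
  refine ⟨fun j => φ.symm (x j), fun j => φ.symm (y j), fun j => (w j).map f, fun j => ?_, ?_⟩
  · obtain ⟨hx, hy, hpath, hsupp, hcol⟩ := hw j
    refine ⟨?_, ?_, hpath.map (f := f) φ.symm.injective, ?_, ?_⟩
    · rw [mem_triSphere_iff, hψn]; exact mem_triSphere_iff.1 hx
    · rw [mem_triSphere_iff, hψn]; exact mem_triSphere_iff.1 hy
    · intro v hv
      rw [SimpleGraph.Walk.support_map, List.mem_map] at hv
      obtain ⟨u, hu, rfl⟩ := hv
      rw [hfapp]
      rcases hsupp u hu with hu' | hu'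
      · left
        simp only [mem_sdiff, Finset.mem_coe, mem_triBall_iff, hψn] at hu' ⊢
        exact hu'
      · right; rw [mem_triSphere_iff, hψn]; exact mem_triSphere_iff.1 hu'
    · intro v hv
      rw [SimpleGraph.Walk.support_map, List.mem_map] at hv
      obtain ⟨u, hu, rfl⟩ := hv
      rw [hfapp, ← hmemξ]
      exact hcol u hu
  · intro i j hij
    rw [Finset.disjoint_left]
    intro v hvi hvj
    rw [List.mem_toFinset, SimpleGraph.Walk.support_map, List.mem_map] at hvi hvj
    obtain ⟨u, hu, rfl⟩ := hvi
    obtain ⟨u', hu', huu'⟩ := hvj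
    rw [hfapp, hfapp] at huu'
    have : u' = u := φ.symm.injective huu'
    subst this
    exact Finset.disjoint_left.1 (hdisj hij) (List.mem_toFinset.2 hu) (List.mem_toFinset.2 hu')

variable {d : ℕ} {ξ : SiteConfig (Site 2)} {Sα Sβ : Set (Site 2)} {a₁ a b₁ b : Site 2}

/-- **Transport of the cut-point lemma** by an automorphism `φ` of `𝕋` fixing `0`, preserving
`triNorm` and the box `[-d, d]²`, which moves `a` to the right side: push the data forward by `φ`,
apply `armEvent_of_cutPoint_right`, pull the arms back. [folklore] -/
theorem armEvent_of_cutPoint_iso (φ : triGraph ≃g triGraph) (hφ0 : φ 0 = 0)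
    (hφn : ∀ z, triNorm (φ z) = triNorm z) (hφP : ∀ z, φ z ∈ triSqBox d ↔ z ∈ triSqBox d)
    (hd : 1 ≤ d) (hSα : Sα ⊆ (triSqBox d \ {0}) ∩ ξ) (hSβ : Sβ ⊆ (triSqBox d \ {0}) ∩ ξ)
    (ha₁ : triGraph.Adj a₁ 0) (hb₁ : triGraph.Adj b₁ 0) (hα : PathIn triGraph Sα a₁ a)
    (hβ : PathIn triGraph Sβ b₁ b) (ha0 : (φ a) 0 = d) (hbd : |(φ b) 0| = d ∨ |(φ b) 1| = d)
    (H : ∀ z ∈ Sα, ∀ z' ∈ Sβ, ¬ PathIn triGraph ((triSqBox d \ {0}) ∩ ξ) z z') :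
    ξ ∈ armEvent ![true, false, true, false] 1 d := by
  set ξ' : SiteConfig (Site 2) := SiteConfig.relabel φ.toEquiv ξ with hξ'
  have hξ'eq : (ξ' : Set (Site 2)) = φ '' ξ := rfl
  have hne0 : ∀ {z : Site 2}, z ≠ 0 → φ z ≠ 0 := fun hz h =>
    hz (φ.injective (h.trans hφ0.symm))
  have himg : ∀ {S : Set (Site 2)}, S ⊆ (triSqBox d \ {0}) ∩ ξ → φ '' S ⊆ (triSqBox d \ {0}) ∩ ξ' := by
    intro S hS
    rintro _ ⟨z, hz, rfl⟩
    obtain ⟨⟨hz1, hz2⟩, hz3⟩ := hS hz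
    exact ⟨⟨(hφP z).2 hz1, hne0 hz2⟩, hξ'eq ▸ mem_image_of_mem _ hz3⟩
  have hadj : ∀ {u : Site 2}, triGraph.Adj u 0 → triGraph.Adj (φ u) 0 := fun hu => by
    rw [← hφ0]; exact φ.map_adj_iff.2 hu
  have H' : ∀ z ∈ φ '' Sα, ∀ z' ∈ φ '' Sβ, ¬ PathIn triGraph ((triSqBox d \ {0}) ∩ ξ') z z' := by
    rintro _ ⟨z, hz, rfl⟩ _ ⟨z', hz', rfl⟩ hp
    have hp' := pathIn_map_iso φ.symm hp
    simp only [RelIso.symm_apply_apply] at hp'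
    refine H z hz z' hz' (hp'.mono ?_)
    rintro _ ⟨w, ⟨⟨hw1, hw2⟩, hw3⟩, rfl⟩
    refine ⟨⟨?_, ?_⟩, ?_⟩
    · have := hφP (φ.symm w); rw [RelIso.apply_symm_apply] at this; exact this.1 hw1
    · intro h0
      apply hw2
      have h0' : φ.symm w = 0 := h0
      have : w = φ (φ.symm w) := (RelIso.apply_symm_apply φ w).symm
      rw [this, h0', hφ0]; rfl
    · rw [hξ'eq] at hw3
      obtain ⟨u, hu, rfl⟩ := hw3
      simpa using hu
  have h := armEvent_of_cutPoint_right hd (himg hSα) (himg hSβ) (hadj ha₁) (hadj hb₁)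
    (pathIn_map_iso φ hα) (pathIn_map_iso φ hβ) ha0 hbd H'
  exact mem_armEvent_of_relabel_iso _ φ hφn h

/-- **The cut-point lemma** (see the module docstring): two open paths inside `[-d, d]² \ {0}`
from neighbours of `0` to boundary sites `a`, `b` of `[-d, d]²` that cannot be joined by an open
path inside `[-d, d]² \ {0}` force four alternating arms from `∂Λ₁` to `∂Λ_d` (Nolin 2008, §6.2,
proof of Thm. 27, Case 1, Fig. 8: "`r₁` provides two black arms, and `c₁` two white arms").
Reduced to `a` on the right side by the symmetries `z ↦ -z`, `(z₀, z₁) ↦ (z₁, z₀)`. [cite: Nolin2008, §6.2, proof of Thm. 27, Case 1 (arXiv 0711.4948: Thm. 26, Fig. 8)] [cite: BollobasRiordan2006, Ch. 5 Lemma 7] -/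
theorem armEvent_of_cutPoint (hd : 1 ≤ d) (hSα : Sα ⊆ (triSqBox d \ {0}) ∩ ξ)
    (hSβ : Sβ ⊆ (triSqBox d \ {0}) ∩ ξ) (ha₁ : triGraph.Adj a₁ 0) (hb₁ : triGraph.Adj b₁ 0)
    (hα : PathIn triGraph Sα a₁ a) (hβ : PathIn triGraph Sβ b₁ b)
    (had : |a 0| = d ∨ |a 1| = d) (hbd : |b 0| = d ∨ |b 1| = d)
    (H : ∀ z ∈ Sα, ∀ z' ∈ Sβ, ¬ PathIn triGraph ((triSqBox d \ {0}) ∩ ξ) z z') :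
    ξ ∈ armEvent ![true, false, true, false] 1 d := by
  have hd0 : (0 : ℤ) ≤ d := by positivity
  -- the four symmetries
  have hnegP : ∀ z : Site 2, triNegIso z ∈ triSqBox d ↔ z ∈ triSqBox d := fun z => by
    simp [mem_triSqBox, abs_neg]
  have hswapP : ∀ z : Site 2, triSwapIso z ∈ triSqBox d ↔ z ∈ triSqBox d := fun z => by
    simp only [mem_triSqBox, triSwapIso_apply, transposeIso_apply_zero, transposeIso_apply_one]
    tauto
  have hnegn : ∀ z : Site 2, triNorm (triNegIso z) = triNorm z := fun z => by
    rw [triNegIso_apply, triNorm_neg]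
  have hswapn : ∀ z : Site 2, triNorm (triSwapIso z) = triNorm z := fun z => by
    rw [triSwapIso_apply, triNorm_transposeIso]
  rcases had with h | h
  · rcases (abs_eq hd0).1 h with h | h
    · exact armEvent_of_cutPoint_right hd hSα hSβ ha₁ hb₁ hα hβ h hbd H
    · refine armEvent_of_cutPoint_iso triNegIso (by simp) hnegn hnegP hd hSα hSβ ha₁ hb₁ hα hβ
        (by rw [triNegIso_apply, Pi.neg_apply, h, neg_neg]) ?_ H
      simpa [abs_neg] using hbd
  · rcases (abs_eq hd0).1 h with h | h
    · refine armEvent_of_cutPoint_iso triSwapIso ?_ hswapn hswapP hd hSα hSβ ha₁ hb₁ hα hβ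
        (by rw [triSwapIso_apply, transposeIso_apply_zero, h]) ?_ H
      · ext i; fin_cases i <;> simp
      · simp only [triSwapIso_apply, transposeIso_apply_zero, transposeIso_apply_one]; tauto
    · refine armEvent_of_cutPoint_iso (triSwapIso.trans triNegIso) ?_ ?_ ?_ hd hSα hSβ ha₁ hb₁ hα
        hβ ?_ ?_ H
      · ext i; fin_cases i <;> simp
      · intro z
        show triNorm (triNegIso (triSwapIso z)) = triNorm z
        rw [hnegn, hswapn]
      · intro z
        show triNegIso (triSwapIso z) ∈ triSqBox d ↔ z ∈ triSqBox d
        rw [hnegP, hswapP]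
      · show (triNegIso (triSwapIso a)) 0 = d
        rw [triNegIso_apply, Pi.neg_apply, triSwapIso_apply, transposeIso_apply_zero, h, neg_neg]
      · show |(triNegIso (triSwapIso b)) 0| = d ∨ |(triNegIso (triSwapIso b)) 1| = d
        simp only [triNegIso_apply, Pi.neg_apply, triSwapIso_apply, transposeIso_apply_zero,
          transposeIso_apply_one, abs_neg]
        tauto

end Symmetry

/-! ### Application: a pivotal site of the one-arm event has four arms locally -/

section OneArm

variable {N d : ℕ} {v : Site 2} {ω : SiteConfig (Site 2)}

/-- **A pivotal site of the one-arm event is a local four-arm site** (Nolin 2008, §6.2, proof of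
Thm. 27, Case 1, Fig. 8; Werner 2009, Lecture 6, §5; Kesten 1987, Lemma 8). If `v` is pivotal
for `{0 ↔ ∂Λ_N}` (`triOneArm N`) in `ω`, `d ≥ 1`, `2d + 1 ≤ |v|_𝕋` and `|v|_𝕋 + 2d ≤ N`, then the
translated configuration `ω - v` lies in `armEvent ![true, false, true, false] 1 d`: the open path
of `ω ∪ {v}` from `0` to `∂Λ_N` passes through `v`; its two halves, seen from `v` and stopped on
the boundary of `v + [-d, d]²`, are open paths that no open path of `ω \ {v}` inside
`v + [-d, d]² ⊆ Λ_N` can join (that would make `ω \ {v} ∈ {0 ↔ ∂Λ_N}`), so the cut-point lemma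
applies. [cite: Nolin2008, §6.2, proof of Thm. 27, Case 1 (arXiv 0711.4948: Thm. 26, Fig. 8)] [cite: WernerPCMI2009, Lecture 6, §5 (figure: a pivotal point for 0 ↔ ∂Λ_n)] -/
theorem relabel_shift_mem_armEvent_of_isPivotal_triOneArm (hd : 1 ≤ d)
    (hv : 2 * (d : ℤ) + 1 ≤ triNorm v) (hvN : triNorm v + 2 * d ≤ N)
    (hpiv : IsPivotal (triOneArm N) v ω) :
    SiteConfig.relabel (triShiftIso (-v)).toEquiv ω ∈ armEvent ![true, false, true, false] 1 d := by
  classical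
  have hd0 : (0 : ℤ) ≤ d := by positivity
  set Λ : Set (Site 2) := ↑(triBall N) with hΛ
  have hΛmem : ∀ {z : Site 2}, z ∈ Λ ↔ triNorm z ≤ N := fun {z} => by
    rw [hΛ, Finset.mem_coe, mem_triBall_iff]
  rw [isPivotal_iff_insert_mem_and_notMem (isUpperSet_triOneArm N)] at hpiv
  obtain ⟨⟨y, hy, hconn⟩, hnot⟩ := hpiv
  rw [mem_triSphere_iff] at hy
  have hγ : PathIn triGraph (Λ ∩ insert v ω) 0 y := PathIn.of_mem_siteConnIn hconn
  set A : Set (Site 2) := (Λ ∩ insert v ω) \ {v} with hA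
  set A' : Set (Site 2) := Λ ∩ (ω \ {v}) with hA'
  have hAsub : A ⊆ A' := inter_insert_diff_subset Λ v ω
  have hv0 : (v : Site 2) ≠ 0 := by
    intro h; rw [h] at hv; simp [triNorm] at hv; omega
  have hyv : y ≠ v := by intro h; rw [h] at hy; omega
  -- the open path passes through `v`
  rcases hγ.split_at v with havoid | ⟨hP, hS⟩
  · exact (hnot ⟨y, mem_triSphere_iff.2 hy, (havoid.mono hAsub).mem_siteConnIn⟩).elim
  obtain ⟨a₁', ha₁', hpre⟩ := hP.resolve_left hv0.symm
  obtain ⟨b₁', hb₁', hsuf⟩ := hS.resolve_left hyv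
  -- translate by `-v`
  set φ := triShiftIso (-v) with hφ
  have hφapp : ∀ w, φ w = w - v := fun w => by simp [hφ, sub_eq_add_neg]
  have himage : ∀ (T : Set (Site 2)) (w : Site 2), w ∈ φ '' T ↔ w + v ∈ T := by
    intro T w
    constructor
    · rintro ⟨w', hw', rfl⟩; rw [hφapp]; simpa using hw'
    · intro hw; exact ⟨w + v, hw, by rw [hφapp]; simp⟩
  set ξ : SiteConfig (Site 2) := SiteConfig.relabel φ.toEquiv ω with hξ
  have hmemξ : ∀ w, w ∈ ξ ↔ w + v ∈ ω := by
    intro w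
    rw [hξ, SiteConfig.mem_relabel_iff]
    have : φ.toEquiv.symm w = w + v := by
      apply φ.toEquiv.injective
      rw [Equiv.apply_symm_apply]
      show w = φ (w + v)
      rw [hφapp]; simp
    rw [this]
  -- the translated half-paths, from neighbours of `0`
  have hα₀ : PathIn triGraph (φ '' A) (φ a₁') (φ 0) := pathIn_map_iso φ hpre.symm
  have hβ₀ : PathIn triGraph (φ '' A) (φ b₁') (φ y) := pathIn_map_iso φ hsuf.symm
  have hadj : ∀ {u : Site 2}, triGraph.Adj u v → triGraph.Adj (φ u) 0 := by
    intro u hu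
    have := φ.map_adj_iff.2 hu
    rwa [show φ v = 0 by rw [hφapp, sub_self]] at this
  -- sites of `φ '' A` are open sites of `ξ` other than `0`
  have hAξ : ∀ w ∈ φ '' A, w ∈ ξ ∧ w ≠ 0 := by
    intro w hw
    rw [himage] at hw
    obtain ⟨⟨-, hw2⟩, hw3⟩ := hw
    have hw3' : w + v ≠ v := hw3
    refine ⟨(hmemξ w).2 ((mem_insert_iff.1 hw2).resolve_left hw3'), fun h => hw3' ?_⟩
    rw [h, zero_add]
  -- the interior of the box; the far endpoints lie outside it
  set R : Set (Site 2) := {z | |z 0| < d ∧ |z 1| < d} with hR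
  have hRmem : ∀ {z : Site 2}, z ∈ R ↔ |z 0| < d ∧ |z 1| < d := fun {z} => Iff.rfl
  have hfar : ∀ {w : Site 2}, 2 * (d : ℤ) ≤ triNorm w → w ∉ R := by
    intro w hw hwR
    obtain ⟨h0, h1⟩ := hwR
    have := triNorm_le_abs_add_abs w
    omega
  have hφ0far : φ 0 ∉ R := by
    apply hfar
    rw [hφapp, zero_sub, triNorm_neg]; omega
  have hφyfar : φ y ∉ R := by
    apply hfar
    rw [hφapp]
    have := triNorm_add_le (y - v) v
    rw [sub_add_cancel] at this
    omega
  -- stopping a half-path on the boundary of the box, with a tight support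
  have stop : ∀ {u₁ e : Site 2}, triGraph.Adj u₁ 0 → e ∉ R → PathIn triGraph (φ '' A) u₁ e →
      ∃ (S : Set (Site 2)) (c : Site 2), S ⊆ triSqBox d ∩ φ '' A ∧ PathIn triGraph S u₁ c ∧
        (|c 0| = d ∨ |c 1| = d) ∧ ∀ z ∈ S, PathIn triGraph (φ '' A) u₁ z := by
    intro u₁ e hu₁ he hp
    have hu₁1 : triNorm u₁ = 1 := by
      have := triNorm_sub_eq_one_of_adj hu₁; rwa [sub_zero] at this
    obtain ⟨hu0, hu1, -⟩ := abs_le_triNorm u₁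
    by_cases huR : u₁ ∈ R
    · obtain ⟨p, q, hpR, hqR, hqA, hpq, hpath⟩ := hp.exit huR he
      have hpath' : PathIn triGraph (insert q (R ∩ φ '' A)) u₁ q :=
        (hpath.mono fun z hz => mem_insert_of_mem _ hz).tail hpq (mem_insert q _)
      obtain ⟨S, hS, hSp, hall⟩ := hpath'.exists_support
      have hq : q ∈ triSqBox d ∧ (|q 0| = d ∨ |q 1| = d) := by
        rw [hRmem, abs_lt, abs_lt] at hpR
        rw [hRmem, not_and_or, not_lt, not_lt, le_abs, le_abs] at hqR
        rw [triGraph_adj_iff_coord] at hpq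
        rw [mem_triSqBox, abs_le, abs_le, abs_eq hd0, abs_eq hd0]
        omega
      have hSsub : S ⊆ triSqBox d ∩ φ '' A := by
        intro z hz
        rcases hS hz with h | ⟨hzR, hzA⟩
        · rw [h]; exact ⟨hq.1, hqA⟩
        · rw [hRmem, abs_lt, abs_lt] at hzR
          exact ⟨by rw [mem_triSqBox, abs_le, abs_le]; omega, hzA⟩
      exact ⟨S, q, hSsub, hSp, hq.2, fun z hz => (hall z hz).mono fun w hw => (hSsub hw).2⟩
    · refine ⟨{u₁}, u₁, ?_, PathIn.refl (mem_singleton u₁), ?_, ?_⟩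
      · intro z hz
        rw [mem_singleton_iff] at hz
        rw [hz]
        exact ⟨by rw [mem_triSqBox]; constructor <;> omega, hp.left_mem⟩
      · rw [hRmem, not_and_or, not_lt, not_lt] at huR
        rcases huR with h | h
        · left; omega
        · right; omega
      · intro z hz
        rw [mem_singleton_iff] at hz
        rw [hz]
        exact PathIn.refl hp.left_mem
  obtain ⟨Sα, a, hSα, hα, had, hallα⟩ := stop (hadj ha₁') hφ0far hα₀
  obtain ⟨Sβ, b, hSβ, hβ, hbd, hallβ⟩ := stop (hadj hb₁') hφyfar hβ₀
  have hSα' : Sα ⊆ (triSqBox d \ {0}) ∩ ξ := fun z hz =>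
    ⟨⟨(hSα hz).1, (hAξ z (hSα hz).2).2⟩, (hAξ z (hSα hz).2).1⟩
  have hSβ' : Sβ ⊆ (triSqBox d \ {0}) ∩ ξ := fun z hz =>
    ⟨⟨(hSβ hz).1, (hAξ z (hSβ hz).2).2⟩, (hAξ z (hSβ hz).2).1⟩
  refine armEvent_of_cutPoint hd hSα' hSβ' (hadj ha₁') (hadj hb₁') hα hβ had hbd ?_
  -- the cut-point hypothesis: an open junction inside the box would bypass `v`
  intro z hz z' hz' hp
  have hT₁ : φ '' A ⊆ φ '' A' := image_mono hAsub
  have hT₂ : (triSqBox d \ {0}) ∩ ξ ⊆ φ '' A' := by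
    rintro w ⟨⟨hw1, hw2⟩, hw3⟩
    rw [himage]
    refine ⟨?_, (hmemξ w).1 hw3, fun h => hw2 ?_⟩
    · rw [hΛmem]
      have h1 := triNorm_add_le w v
      have h2 := triNorm_le_abs_add_abs w
      rw [mem_triSqBox] at hw1
      omega
    · have : w + v = v := h
      simpa using this
  have hjoin : PathIn triGraph (φ '' A') (φ 0) (φ y) :=
    (((hα₀.symm.trans (hallα z hz)).mono hT₁).trans (hp.mono hT₂)).trans
      (((hallβ z' hz').symm.trans hβ₀).mono hT₁)
  -- translate back by `+v`
  have hback := pathIn_map_iso (triShiftIso v) hjoin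
  have e1 : ∀ w, triShiftIso v (φ w) = w := fun w => by rw [triShiftIso_apply, hφapp]; abel
  rw [e1, e1] at hback
  have hset : (triShiftIso v) '' (φ '' A') = A' := by
    ext u
    constructor
    · rintro ⟨w, hw, rfl⟩
      rw [himage] at hw
      rw [triShiftIso_apply]; exact hw
    · intro hu
      refine ⟨u - v, (himage A' (u - v)).2 (by rwa [sub_add_cancel]), ?_⟩
      rw [triShiftIso_apply, sub_add_cancel]
  rw [hset] at hback
  exact hnot ⟨y, mem_triSphere_iff.2 hy, hback.mem_siteConnIn⟩

end OneArm

end Literature.Probability.Percolation
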